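import Summits.ValiantsHypothesis.ValiantsHypothesis.Theorems.SymPencilSingFiveClassificationFive
import Summits.ValiantsHypothesis.ValiantsHypothesis.Theorems.SymPencilSdcPerFourCellElevenFiveTwentyEight
import Summits.ValiantsHypothesis.ValiantsHypothesis.Theorems.SymPencilSingFiveLeafCrossFive
import Summits.ValiantsHypothesis.ValiantsHypothesis.Theorems.SymPencilPerFourWcolHyperplaneFive

/-!
# Route `SymPencil` — row `r = 11` of the size-`28` kernel-package table is EMPTY, unconditionally
# (`--supports` stmt-ValiantsHypothesis-5674 `SdcSuperquadratic`; part (d3) of the `(11, 5, 5)` plan — the assembly by name;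
# rung currency only — nothing here bears on `VP ≠ VNP`)

The three named inputs of the five-square dispatch ✓ `SymPencilSingFiveClassificationFive.noJointFamily_five_five_of` are
now tree theorems, and this file only composes them:

* `leafX_five` — leaf X at five (✓ `SymPencilSingFiveClassification.crossFive_five`, the ✓ `leafX` wrapper text): a
  `5`-dimensional `W` in a cross with a per-direction family of five squares is of `V₅×`-type;
* ✓ `SymPencilSingFiveBricksFive.noJoint_of_vFiveCrossType_five` — the `V₅×` brick at five;
* ✓ `SymPencilPerFourWcolHyperplaneFive.noJointFive_of_inWCol` — leaf E at five (no joint family of five squares on a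
  `5`-dimensional `W ⊆ W_col(p,q;m)`: discriminant-free radical-line argument for the non-torus hyperplanes, the torus
  bricks at five ✓ `SymPencilSingFiveBricksFive.torusDispatch_five` for the torus ones);

hence **`noJointFamily_five_five`**: no `5`-dimensional `W ⊆ Sing₃` carries a JOINT family of FIVE squares; and, through the
✓ template `SymPencilSdcPerFourCellElevenFiveTwentyEight.false_of_rank_eleven_le_twentyEight_of_noJointFive`,
**`false_of_rank_eleven_le_twentyEight`**: no symmetric affine determinantal representation of `per₄` of size `m ≤ 28` over a
field of characteristic `0` has base-point inner rank `11` — row `r = 11` of the size-`28` table is CLOSED.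

Honest framing: [folklore] assembly by name; ONE row of the six-row size-`28` table; the words of record `28 ≤ sdc(per₄) ≤ 29`
are UNCHANGED by this file (the other rows are separate theorems; `sdc(per₄) = 29` is NOT claimed here); stmt-5674
`SdcSuperquadratic` stays OPEN; `VP ≠ VNP` is not moved; no summit statement is proved here.  No definitions, no named facts.
-/

noncomputable section

-- single-conjunct layout: Sub = Summit, duplicated namespace component intended
set_option linter.dupNamespace false

namespace Summit.ValiantsHypothesis.ValiantsHypothesis.Theorems.SymPencilSdcPerFourCellElevenFiveTwentyEight

open MvPolynomial Module Matrix
open Literature.Computability.AlgebraicComplexity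
open Summit.ValiantsHypothesis.ValiantsHypothesis.Theorems
open Summit.ValiantsHypothesis.ValiantsHypothesis.Theorems.SymPencilSingSixClassification
open Summit.ValiantsHypothesis.ValiantsHypothesis.Theorems.SymPencilSingFiveClassification
open Summit.ValiantsHypothesis.ValiantsHypothesis.Theorems.SymPencilSingFiveClassificationFive

variable {K : Type*} [Field K]

/-- **Leaf X at five** (the ✓ `leafX` wrapper over ✓ `crossFive_five`): a `5`-dimensional `W` in a cross with a
per-direction family of FIVE squares is of `V₅×`-type. [folklore] -/
theorem leafX_five [CharZero K] :
    ∀ W : Submodule K (Fin 4 × Fin 4 → K), finrank K W = 5 → InCross W →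
      (∀ y ∈ W, ∃ (c : Fin 5 → K) (Λ : Fin 5 → ((Fin 4 × Fin 4 → K) →ₗ[K] K)),
        ∀ u : Fin 4 × Fin 4 → K, ∃ e₀ e₁ : K, ∀ s : K,
          eval (u + s • y) (perPoly (Fin 4) K) = e₀ + s * e₁ + s ^ 2 * ∑ k, c k * (Λ k u) ^ 2) →
      VFiveCrossType W := by
  intro W h5 hX hW
  obtain ⟨l, c, hX⟩ := hX
  obtain ⟨a, b, hac, hbl, hmem⟩ := crossFive_five W hX h5 hW
  exact ⟨l, c, a, b, hac, hbl, hmem⟩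

/-- **`noJointFamily_five_five`** — the V-side statement of row `r = 11` of the size-`28` table: no `5`-dimensional
`W ⊆ Sing Z(per₄)` carries a JOINT family of FIVE squares (✓ dispatch `noJointFamily_five_five_of` with its three inputs
discharged BY NAME: `leafX_five`, ✓ `noJoint_of_vFiveCrossType_five`, ✓ `noJointFive_of_inWCol`). [folklore] -/
theorem noJointFamily_five_five [CharZero K] :
    ∀ W : Submodule K (Fin 4 × Fin 4 → K), Sing3 W → finrank K W = 5 →
      ∀ (c : Fin 5 → K) (β : Fin 5 → ((Fin 4 × Fin 4 → K) →ₗ[K] (Fin 4 × Fin 4 → K) →ₗ[K] K)),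
        ¬ (∀ u : Fin 4 × Fin 4 → K, ∀ y ∈ W, ∃ e₀ e₁ : K, ∀ s : K,
          eval (u + s • y) (perPoly (Fin 4) K) = e₀ + s * e₁ + s ^ 2 * ∑ k, c k * (β k u y) ^ 2) :=
  noJointFamily_five_five_of leafX_five
    (fun _ h => SymPencilSingFiveBricksFive.noJoint_of_vFiveCrossType_five h)
    (fun W h5 p q m hpq hI c β => SymPencilPerFourWcolHyperplaneFive.noJointFive_of_inWCol W h5 p q m hpq hI c β)

/-- **Row `r = 11` of the size-`28` kernel-package table is EMPTY** (✓ template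
`false_of_rank_eleven_le_twentyEight_of_noJointFive` with its hypothesis `hV` discharged by `noJointFamily_five_five`;
hypotheses exactly as exported by `SymPencilPerFourBasePointPackage.basepoint_package_of_isSymm_isAffineDetRepr_perPoly_four`).
Rung currency only: ONE row; `28 ≤ sdc(per₄) ≤ 29` is UNCHANGED by this file alone; the crux `SdcSuperquadratic` and
`VP ≠ VNP` untouched. [folklore] -/
theorem false_of_rank_eleven_le_twentyEight (K : Type*) [Field K] [CharZero K]
    {m : ℕ} (hm : m ≤ 28)
    {i₀ : Fin m} {D : Matrix {i // i ≠ i₀} {i // i ≠ i₀} K}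
    {bL : (Fin 4 × Fin 4 → K) →ₗ[K] ({i // i ≠ i₀} → K)}
    {CL : (Fin 4 × Fin 4 → K) →ₗ[K] Matrix {i // i ≠ i₀} {i // i ≠ i₀} K} {κ : K}
    (hD : IsUnit D.det) (hDs : Dᵀ = D) (hCs : ∀ z, (CL z)ᵀ = CL z) (hκ : κ ≠ 0)
    (hi : ∀ z, bL z ⬝ᵥ D⁻¹ *ᵥ bL z = 0)
    (hii : ∀ z, bL z ⬝ᵥ (D⁻¹ * CL z * D⁻¹) *ᵥ bL z = 0)
    (hiii : ∀ z, D.det * (bL z ⬝ᵥ (D⁻¹ * CL z * D⁻¹ * CL z * D⁻¹) *ᵥ bL z) =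
      -(κ * eval z (perPoly (Fin 4) K)))
    (hV4 : ∀ x ∈ LinearMap.ker bL, ∀ r c : Fin 4,
      ((Matrix.of fun i j => x (i, j)).submatrix r.succAbove c.succAbove).permanent = 0)
    (hcard : Fintype.card {i // i ≠ i₀} + 1 = m)
    (hranle : 2 * finrank K (LinearMap.range bL) ≤ Fintype.card {i // i ≠ i₀})
    (hrn : finrank K (LinearMap.range bL) + finrank K (LinearMap.ker bL) = 16)
    (hN : ∀ v, bL v = 0 → IsUnit (D + CL v).det ∧ ∀ (z : Fin 4 × Fin 4 → K) (s : K),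
      κ * eval (v + s • z) (perPoly (Fin 4) K) =
        (Matrix.fromBlocks ((s * 0) • (1 : Matrix Unit Unit K))
          (Matrix.replicateRow Unit (s • bL z)) (Matrix.replicateCol Unit (s • bL z))
          (D + CL v + s • CL z)).det)
    (h11 : finrank K (LinearMap.range bL) = 11) : False :=
  false_of_rank_eleven_le_twentyEight_of_noJointFive K hm hD hDs hCs hκ hi hii hiii hV4 hcard hranle hrn hN
    (fun W hS h5 c β => noJointFamily_five_five W hS h5 c β) h11

end Summit.ValiantsHypothesis.ValiantsHypothesis.Theorems.SymPencilSdcPerFourCellElevenFiveTwentyEight
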